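import Mathlib.Tactic.Ring
import Mathlib.Tactic.Linarith
import Mathlib.Tactic.LinearCombination
import Mathlib.Data.Real.Basic
import HarnessLib

/-!
# Conjecture N (hodge-weil ladder, GAPS G51b), format (4,2): escape directions and the two-scale expansion of `Q₂`

Prover 2, generation 11 (note `run/shared/lean/b2b/hodge-weil/b2b-hweil-pv2-g11/CROSS-MAX-G11.md` §3). Setting of
`b2b-hweil-pv2-g9/CONJECTURE-N.md` §1 in format `(4,2)`: `E`-roots with positions `A₁,…,A₄` and real charges `u₁,…,u₄`,
`F`-roots with positions `B₁,B₂` and charges `v₁,v₂`, signed sums `Σε = Σ_E − Σ_F`; `P1 = ΣεA²u`, `P2 = ΣεAu²`,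
`Q₂ = ½(ΣεA²)(Σεu²) + (ΣεAu)² − 3ΣεA²u²`, `S_u = Σεu²`. For FIXED centred charges the positions form a vector `X`, and Conjecture N
in format (4,2) is the statement `min {Q₂(X) : X centred, P2(X) = 0, P1(X) = 0, A_i − B_j ≥ |u_i − v_j|} ≥ −Q₄` (note §2).
The three facts below are exact polynomial identities (kernel: `ring` / `linear_combination`); they are the algebra behind the
note's structural statements: (1) the ESCAPE DIRECTION of an `E`-root (`A₁ = a`, all other roots at `−a`) is centred, satisfies
`P1 = 0` identically, and has `P2 = a(2u₁² − S_u)`, `Q₂ = 2a²(2u₁² − S_u)` — so on the hypersurface `2u₁² = S_u` it is a pure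
dominant direction on which `Q₂` vanishes (every degree-2 certificate is singular there); (2) the ESCAPE DIRECTION of a pair
`(E₁,F₁)` (`A₁ = b+p`, `B₁ = b−q`, the other four roots at `b = −(p+q)/2`) is pure with `Q₂ = 0` exactly when
`p(u₁+v₁) + 2qv₁ = 0` and `(p+q)S_u = 2(pu₁² + qv₁²)`; (3) the TWO-SCALE EXPANSION: writing the positions as `A₁ = a`, all other
roots at `−a +` (offset), `P1`, `P2`, `Q₂` are explicit polynomials in `a` whose leading behaviour on pure configurations is
`Q₂ = 4a·Σ_Cε·y·z² + O(1)` (`C` = the five other roots). Nothing here is a rung, a door edge or a cited fact; no statement of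
Markman's papers is used. New (unpublished) cell result, hence under Summits/.
-/

set_option linter.dupNamespace false

namespace Summit.HodgeConjecture.HodgeConjecture.WeilClassTestEscapeDirections

/-- ESCAPE DIRECTION OF AN E-ROOT (type (i)). With centred charges (`u₁+u₂+u₃+u₄ = v₁+v₂`) and the position vector
`A₁ = a`, `A₂ = A₃ = A₄ = B₁ = B₂ = −a` (centred: `ΣεA = a − 3a + 2a = 0`): `P1 = 0` identically, `P2 = a·(2u₁² − S_u)` and
`Q₂ = 2a²·(2u₁² − S_u)`, where `S_u = Σεu²`. Hence on the wall `2u₁² = S_u` this direction lies in the closed pure dominant cone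
(`A₁ − B_j = 2a ≥ 0`, `A_i − B_j = 0` otherwise, for `a ≥ 0`) and `Q₂` vanishes on it. -/
theorem escapeE_identities (a u₁ u₂ u₃ u₄ v₁ v₂ : ℝ) (hc : u₁ + u₂ + u₃ + u₄ = v₁ + v₂) :
    (a ^ 2 * u₁ + (-a) ^ 2 * u₂ + (-a) ^ 2 * u₃ + (-a) ^ 2 * u₄ - ((-a) ^ 2 * v₁ + (-a) ^ 2 * v₂) = 0)
    ∧ (a * u₁ ^ 2 + (-a) * u₂ ^ 2 + (-a) * u₃ ^ 2 + (-a) * u₄ ^ 2 - ((-a) * v₁ ^ 2 + (-a) * v₂ ^ 2)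
        = a * (2 * u₁ ^ 2 - (u₁ ^ 2 + u₂ ^ 2 + u₃ ^ 2 + u₄ ^ 2 - v₁ ^ 2 - v₂ ^ 2)))
    ∧ (1 / 2 * (a ^ 2 + (-a) ^ 2 + (-a) ^ 2 + (-a) ^ 2 - ((-a) ^ 2 + (-a) ^ 2))
          * (u₁ ^ 2 + u₂ ^ 2 + u₃ ^ 2 + u₄ ^ 2 - (v₁ ^ 2 + v₂ ^ 2))
        + (a * u₁ + (-a) * u₂ + (-a) * u₃ + (-a) * u₄ - ((-a) * v₁ + (-a) * v₂)) ^ 2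
        - 3 * (a ^ 2 * u₁ ^ 2 + (-a) ^ 2 * u₂ ^ 2 + (-a) ^ 2 * u₃ ^ 2 + (-a) ^ 2 * u₄ ^ 2
            - ((-a) ^ 2 * v₁ ^ 2 + (-a) ^ 2 * v₂ ^ 2))
        = 2 * a ^ 2 * (2 * u₁ ^ 2 - (u₁ ^ 2 + u₂ ^ 2 + u₃ ^ 2 + u₄ ^ 2 - v₁ ^ 2 - v₂ ^ 2))) := by
  have hv : v₂ = u₁ + u₂ + u₃ + u₄ - v₁ := by linarith
  subst hv
  refine ⟨by ring, by ring, by ring⟩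

/-- ESCAPE DIRECTION OF A PAIR `(E₁,F₁)` (type (iv)). Centred charges; positions `A₁ = b + p`, `B₁ = b − q`,
`A₂ = A₃ = A₄ = B₂ = b` with `b = −(p+q)/2` (so `ΣεA = 0`). Then `P1 = −q·(p(u₁+v₁) + 2qv₁)` and
`P2 = −½·((p+q)S_u − 2(pu₁² + qv₁²))`; and `(p+q)·Q₂` is an explicit combination of the same two wall quantities. Consequently,
when `p(u₁+v₁) + 2qv₁ = 0` and `(p+q)S_u = 2(pu₁² + qv₁²)` (with `p, q ≥ 0`, `p+q > 0`), the direction is pure, dominant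
(`A₁ − B₁ = p+q`, `A₁ − B₂ = p`, `A_i − B₁ = q`, `A_i − B₂ = 0`) and `Q₂` vanishes on it. -/
theorem escapeEF_identities (p q u₁ u₂ u₃ u₄ v₁ v₂ : ℝ) (hc : u₁ + u₂ + u₃ + u₄ = v₁ + v₂) :
    let b : ℝ := -(p + q) / 2
    ((b + p) ^ 2 * u₁ + b ^ 2 * u₂ + b ^ 2 * u₃ + b ^ 2 * u₄ - ((b - q) ^ 2 * v₁ + b ^ 2 * v₂)
        = -q * (p * (u₁ + v₁) + 2 * q * v₁))
    ∧ ((b + p) * u₁ ^ 2 + b * u₂ ^ 2 + b * u₃ ^ 2 + b * u₄ ^ 2 - ((b - q) * v₁ ^ 2 + b * v₂ ^ 2)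
        = -(1 / 2) * ((p + q) * (u₁ ^ 2 + u₂ ^ 2 + u₃ ^ 2 + u₄ ^ 2 - v₁ ^ 2 - v₂ ^ 2) - 2 * (p * u₁ ^ 2 + q * v₁ ^ 2)))
    ∧ ((p + q) * (1 / 2 * ((b + p) ^ 2 + b ^ 2 + b ^ 2 + b ^ 2 - ((b - q) ^ 2 + b ^ 2))
          * (u₁ ^ 2 + u₂ ^ 2 + u₃ ^ 2 + u₄ ^ 2 - (v₁ ^ 2 + v₂ ^ 2))
        + ((b + p) * u₁ + b * u₂ + b * u₃ + b * u₄ - ((b - q) * v₁ + b * v₂)) ^ 2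
        - 3 * ((b + p) ^ 2 * u₁ ^ 2 + b ^ 2 * u₂ ^ 2 + b ^ 2 * u₃ ^ 2 + b ^ 2 * u₄ ^ 2
            - ((b - q) ^ 2 * v₁ ^ 2 + b ^ 2 * v₂ ^ 2)))
        = (-(1 / 2) * p ^ 2 - 2 * p * q - 3 / 2 * q ^ 2)
            * ((p + q) * (u₁ ^ 2 + u₂ ^ 2 + u₃ ^ 2 + u₄ ^ 2 - v₁ ^ 2 - v₂ ^ 2) - 2 * (p * u₁ ^ 2 + q * v₁ ^ 2))
          + 2 * q * v₁ * (p + q) * (p * (u₁ + v₁) + 2 * q * v₁)) := by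
  intro b
  have hv : v₂ = u₁ + u₂ + u₃ + u₄ - v₁ := by linarith
  subst hv
  refine ⟨by simp only [b]; ring, by simp only [b]; ring, by simp only [b]; ring⟩

/-- Corollary of `escapeEF_identities`: on the type-(iv) wall the pair escape direction is pure and `Q₂`-null
(`p + q ≠ 0`). -/
theorem escapeEF_pure_null (p q u₁ u₂ u₃ u₄ v₁ v₂ : ℝ) (hc : u₁ + u₂ + u₃ + u₄ = v₁ + v₂) (hpq : p + q ≠ 0)
    (hw1 : p * (u₁ + v₁) + 2 * q * v₁ = 0)
    (hw2 : (p + q) * (u₁ ^ 2 + u₂ ^ 2 + u₃ ^ 2 + u₄ ^ 2 - v₁ ^ 2 - v₂ ^ 2) = 2 * (p * u₁ ^ 2 + q * v₁ ^ 2)) :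
    let b : ℝ := -(p + q) / 2
    ((b + p) ^ 2 * u₁ + b ^ 2 * u₂ + b ^ 2 * u₃ + b ^ 2 * u₄ - ((b - q) ^ 2 * v₁ + b ^ 2 * v₂) = 0)
    ∧ ((b + p) * u₁ ^ 2 + b * u₂ ^ 2 + b * u₃ ^ 2 + b * u₄ ^ 2 - ((b - q) * v₁ ^ 2 + b * v₂ ^ 2) = 0)
    ∧ (1 / 2 * ((b + p) ^ 2 + b ^ 2 + b ^ 2 + b ^ 2 - ((b - q) ^ 2 + b ^ 2))
          * (u₁ ^ 2 + u₂ ^ 2 + u₃ ^ 2 + u₄ ^ 2 - (v₁ ^ 2 + v₂ ^ 2))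
        + ((b + p) * u₁ + b * u₂ + b * u₃ + b * u₄ - ((b - q) * v₁ + b * v₂)) ^ 2
        - 3 * ((b + p) ^ 2 * u₁ ^ 2 + b ^ 2 * u₂ ^ 2 + b ^ 2 * u₃ ^ 2 + b ^ 2 * u₄ ^ 2
            - ((b - q) ^ 2 * v₁ ^ 2 + b ^ 2 * v₂ ^ 2)) = 0) := by
  intro b
  obtain ⟨h1, h2, h3⟩ := escapeEF_identities p q u₁ u₂ u₃ u₄ v₁ v₂ hc
  refine ⟨?_, ?_, ?_⟩
  · rw [h1, hw1]; ring
  · rw [h2]; linear_combination (-(1 / 2) : ℝ) * hw2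
  · have hw2' : (p + q) * (u₁ ^ 2 + u₂ ^ 2 + u₃ ^ 2 + u₄ ^ 2 - v₁ ^ 2 - v₂ ^ 2) - 2 * (p * u₁ ^ 2 + q * v₁ ^ 2) = 0 := by
      linarith
    have hprod := h3
    rw [hw1, hw2'] at hprod
    simp only [mul_zero, add_zero] at hprod
    exact (mul_eq_zero.mp hprod).resolve_left hpq

/-- TWO-SCALE (E₁-adapted) EXPANSION. Write the positions as `A₁ = a`, `A_k = −a + y_k` (`k = 2,3,4`), `B_j = −a + w_j`,
with the offsets centred (`y₂+y₃+y₄ = w₁+w₂`, so `ΣεA = 0`) and the charges centred (`u₁+u₂+u₃+u₄ = v₁+v₂`). With the cluster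
sums `S_y = Σ_Cεy²`, `S_z = Σ_Cεz²`, `S_yz = Σ_Cεyz`, `S_{yz²} = Σ_Cεyz²`, `S_{y²z} = Σ_Cεy²z`, `S_{y²z²} = Σ_Cεy²z²` over the five
roots `C = {E₂,E₃,E₄,F₁,F₂}` (charges `z = u` resp. `v`):
`P1 = −2a·S_yz + S_{y²z}`, `P2 = a(u₁² − S_z) + S_{yz²}`,
`Q₂ = 2a²(u₁² − S_z) + ½S_y(u₁² + S_z) + 4au₁S_yz + S_yz² + 6aS_{yz²} − 3S_{y²z²}`. -/
theorem twoScale_identities (a y₂ y₃ y₄ w₁ w₂ u₁ u₂ u₃ u₄ v₁ v₂ : ℝ)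
    (hy : y₂ + y₃ + y₄ = w₁ + w₂) (hc : u₁ + u₂ + u₃ + u₄ = v₁ + v₂) :
    let Sy : ℝ := y₂ ^ 2 + y₃ ^ 2 + y₄ ^ 2 - w₁ ^ 2 - w₂ ^ 2
    let Sz : ℝ := u₂ ^ 2 + u₃ ^ 2 + u₄ ^ 2 - v₁ ^ 2 - v₂ ^ 2
    let Syz : ℝ := y₂ * u₂ + y₃ * u₃ + y₄ * u₄ - w₁ * v₁ - w₂ * v₂
    let Syz2 : ℝ := y₂ * u₂ ^ 2 + y₃ * u₃ ^ 2 + y₄ * u₄ ^ 2 - w₁ * v₁ ^ 2 - w₂ * v₂ ^ 2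
    let Sy2z : ℝ := y₂ ^ 2 * u₂ + y₃ ^ 2 * u₃ + y₄ ^ 2 * u₄ - w₁ ^ 2 * v₁ - w₂ ^ 2 * v₂
    let Sy2z2 : ℝ := y₂ ^ 2 * u₂ ^ 2 + y₃ ^ 2 * u₃ ^ 2 + y₄ ^ 2 * u₄ ^ 2 - w₁ ^ 2 * v₁ ^ 2 - w₂ ^ 2 * v₂ ^ 2
    -- P1
    (a ^ 2 * u₁ + (-a + y₂) ^ 2 * u₂ + (-a + y₃) ^ 2 * u₃ + (-a + y₄) ^ 2 * u₄
        - ((-a + w₁) ^ 2 * v₁ + (-a + w₂) ^ 2 * v₂) = -2 * a * Syz + Sy2z)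
    -- P2
    ∧ (a * u₁ ^ 2 + (-a + y₂) * u₂ ^ 2 + (-a + y₃) * u₃ ^ 2 + (-a + y₄) * u₄ ^ 2
        - ((-a + w₁) * v₁ ^ 2 + (-a + w₂) * v₂ ^ 2) = a * (u₁ ^ 2 - Sz) + Syz2)
    -- Q₂
    ∧ (1 / 2 * (a ^ 2 + (-a + y₂) ^ 2 + (-a + y₃) ^ 2 + (-a + y₄) ^ 2 - ((-a + w₁) ^ 2 + (-a + w₂) ^ 2))
          * (u₁ ^ 2 + u₂ ^ 2 + u₃ ^ 2 + u₄ ^ 2 - (v₁ ^ 2 + v₂ ^ 2))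
        + (a * u₁ + (-a + y₂) * u₂ + (-a + y₃) * u₃ + (-a + y₄) * u₄ - ((-a + w₁) * v₁ + (-a + w₂) * v₂)) ^ 2
        - 3 * (a ^ 2 * u₁ ^ 2 + (-a + y₂) ^ 2 * u₂ ^ 2 + (-a + y₃) ^ 2 * u₃ ^ 2 + (-a + y₄) ^ 2 * u₄ ^ 2
            - ((-a + w₁) ^ 2 * v₁ ^ 2 + (-a + w₂) ^ 2 * v₂ ^ 2))
        = 2 * a ^ 2 * (u₁ ^ 2 - Sz) + 1 / 2 * Sy * (u₁ ^ 2 + Sz) + 4 * a * u₁ * Syz + Syz ^ 2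
          + 6 * a * Syz2 - 3 * Sy2z2) := by
  intro Sy Sz Syz Syz2 Sy2z Sy2z2
  have hw : w₂ = y₂ + y₃ + y₄ - w₁ := by linarith
  have hv : v₂ = u₁ + u₂ + u₃ + u₄ - v₁ := by linarith
  subst hw; subst hv
  refine ⟨by simp only [Syz, Sy2z]; ring, by simp only [Sz, Syz2]; ring, by simp only [Sy, Sz, Syz, Syz2, Sy2z2]; ring⟩

/-- Corollary (pure configurations): with `P1 = 0` and `P2 = 0` the expansion collapses to
`Q₂ = 4a·S_{yz²} + 2u₁·S_{y²z} + ½S_y·S_u + S_yz² − 3S_{y²z²}` (`S_u = u₁² + S_z`): along the escape of `E₁`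
(`a → ∞`, cluster fixed) `Q₂` grows LINEARLY with slope `4S_{yz²}`. -/
theorem twoScale_pure (a y₂ y₃ y₄ w₁ w₂ u₁ u₂ u₃ u₄ v₁ v₂ : ℝ)
    (hy : y₂ + y₃ + y₄ = w₁ + w₂) (hc : u₁ + u₂ + u₃ + u₄ = v₁ + v₂)
    (hP1 : a ^ 2 * u₁ + (-a + y₂) ^ 2 * u₂ + (-a + y₃) ^ 2 * u₃ + (-a + y₄) ^ 2 * u₄
        - ((-a + w₁) ^ 2 * v₁ + (-a + w₂) ^ 2 * v₂) = 0)
    (hP2 : a * u₁ ^ 2 + (-a + y₂) * u₂ ^ 2 + (-a + y₃) * u₃ ^ 2 + (-a + y₄) * u₄ ^ 2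
        - ((-a + w₁) * v₁ ^ 2 + (-a + w₂) * v₂ ^ 2) = 0) :
    1 / 2 * (a ^ 2 + (-a + y₂) ^ 2 + (-a + y₃) ^ 2 + (-a + y₄) ^ 2 - ((-a + w₁) ^ 2 + (-a + w₂) ^ 2))
          * (u₁ ^ 2 + u₂ ^ 2 + u₃ ^ 2 + u₄ ^ 2 - (v₁ ^ 2 + v₂ ^ 2))
        + (a * u₁ + (-a + y₂) * u₂ + (-a + y₃) * u₃ + (-a + y₄) * u₄ - ((-a + w₁) * v₁ + (-a + w₂) * v₂)) ^ 2
        - 3 * (a ^ 2 * u₁ ^ 2 + (-a + y₂) ^ 2 * u₂ ^ 2 + (-a + y₃) ^ 2 * u₃ ^ 2 + (-a + y₄) ^ 2 * u₄ ^ 2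
            - ((-a + w₁) ^ 2 * v₁ ^ 2 + (-a + w₂) ^ 2 * v₂ ^ 2))
      = 4 * a * (y₂ * u₂ ^ 2 + y₃ * u₃ ^ 2 + y₄ * u₄ ^ 2 - w₁ * v₁ ^ 2 - w₂ * v₂ ^ 2)
        + 2 * u₁ * (y₂ ^ 2 * u₂ + y₃ ^ 2 * u₃ + y₄ ^ 2 * u₄ - w₁ ^ 2 * v₁ - w₂ ^ 2 * v₂)
        + 1 / 2 * (y₂ ^ 2 + y₃ ^ 2 + y₄ ^ 2 - w₁ ^ 2 - w₂ ^ 2)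
            * (u₁ ^ 2 + (u₂ ^ 2 + u₃ ^ 2 + u₄ ^ 2 - v₁ ^ 2 - v₂ ^ 2))
        + (y₂ * u₂ + y₃ * u₃ + y₄ * u₄ - w₁ * v₁ - w₂ * v₂) ^ 2
        - 3 * (y₂ ^ 2 * u₂ ^ 2 + y₃ ^ 2 * u₃ ^ 2 + y₄ ^ 2 * u₄ ^ 2 - w₁ ^ 2 * v₁ ^ 2 - w₂ ^ 2 * v₂ ^ 2) := by
  obtain ⟨h1, h2, h3⟩ := twoScale_identities a y₂ y₃ y₄ w₁ w₂ u₁ u₂ u₃ u₄ v₁ v₂ hy hc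
  rw [h1] at hP1
  rw [h2] at hP2
  rw [h3]
  linear_combination (-(2 * u₁)) * hP1 + (2 * a) * hP2

/-! ### Appendix (same seat): the CLUSTER FORM of `G₀` — the escaping root's position eliminated

With `E₁` at `a`, the other five roots at `−a + (offset)` (offsets `y₂,y₃,y₄ | w₁,w₂`, centred), and the cluster charges measured
from `−u₁` — `ζ_k := z_k + u₁`, i.e. `u_k = ζ_k − u₁` (`k = 2,3,4`), `v_j = η_j − u₁`, centred: `ζ₂+ζ₃+ζ₄ = η₁+η₂` — the purity
residuals are `P1 = π₁ := S_{y²ζ} − u₁S_y − 2aS_{yζ}`, `P2 = π₂ := S_{yζ²} − 2u₁S_{yζ} − aS_ζ`, `P4 = π₄ := S_{ζ³} − 3u₁S_ζ` (cluster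
signed sums), and `S_ζ·G₀` is a polynomial in the CLUSTER DATA AND `u₁` ALONE modulo `(π₁, π₂, π₄)`:
`S_ζ·(Q₂+Q₄) ≡ 4S_{yζ²}² + 4u₁²(S_yS_ζ − 4S_{yζ}² − 6S_ζ²) + S_ζ(½S_yS_ζ + S_{yζ}² − 3S_{y²ζ²} + 3S_{ζ⁴} − (3/2)S_ζ²)`.
(On pure configurations with `S_ζ ≠ 0` moreover `u₁ = S_{ζ³}/(3S_ζ)` and `a = (S_{yζ²} − 2u₁S_{yζ})/S_ζ`: the sign of `G₀` is decided by
the five-root cluster; note `S_ζ = S_u − 2u₁²` is minus the wall function of `escapeE_identities`.) -/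

/-- CLUSTER FORM of `G₀` (an identity; no hypothesis beyond the two centrings, which are substituted). -/
theorem clusterForm_identity (a y₂ y₃ y₄ w₁ ζ₂ ζ₃ ζ₄ η₁ u₁ : ℝ) :
    let w₂ : ℝ := y₂ + y₃ + y₄ - w₁
    let η₂ : ℝ := ζ₂ + ζ₃ + ζ₄ - η₁
    let Sy : ℝ := y₂ ^ 2 + y₃ ^ 2 + y₄ ^ 2 - w₁ ^ 2 - w₂ ^ 2
    let Sz : ℝ := ζ₂ ^ 2 + ζ₃ ^ 2 + ζ₄ ^ 2 - η₁ ^ 2 - η₂ ^ 2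
    let Syz : ℝ := y₂ * ζ₂ + y₃ * ζ₃ + y₄ * ζ₄ - w₁ * η₁ - w₂ * η₂
    let Syz2 : ℝ := y₂ * ζ₂ ^ 2 + y₃ * ζ₃ ^ 2 + y₄ * ζ₄ ^ 2 - w₁ * η₁ ^ 2 - w₂ * η₂ ^ 2
    let Sy2z : ℝ := y₂ ^ 2 * ζ₂ + y₃ ^ 2 * ζ₃ + y₄ ^ 2 * ζ₄ - w₁ ^ 2 * η₁ - w₂ ^ 2 * η₂
    let Sy2z2 : ℝ := y₂ ^ 2 * ζ₂ ^ 2 + y₃ ^ 2 * ζ₃ ^ 2 + y₄ ^ 2 * ζ₄ ^ 2 - w₁ ^ 2 * η₁ ^ 2 - w₂ ^ 2 * η₂ ^ 2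
    let Sz3 : ℝ := ζ₂ ^ 3 + ζ₃ ^ 3 + ζ₄ ^ 3 - η₁ ^ 3 - η₂ ^ 3
    let Sz4 : ℝ := ζ₂ ^ 4 + ζ₃ ^ 4 + ζ₄ ^ 4 - η₁ ^ 4 - η₂ ^ 4
    let π₁ : ℝ := Sy2z - u₁ * Sy - 2 * a * Syz
    let π₂ : ℝ := Syz2 - 2 * u₁ * Syz - a * Sz
    let π₄ : ℝ := Sz3 - 3 * u₁ * Sz
    -- the configuration: E₁ = (a, u₁); E_k = (−a + y_k, ζ_k − u₁); F_j = (−a + w_j, η_j − u₁)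
    let SA : ℝ := a ^ 2 + (-a + y₂) ^ 2 + (-a + y₃) ^ 2 + (-a + y₄) ^ 2 - ((-a + w₁) ^ 2 + (-a + w₂) ^ 2)
    let Su : ℝ := u₁ ^ 2 + (ζ₂ - u₁) ^ 2 + (ζ₃ - u₁) ^ 2 + (ζ₄ - u₁) ^ 2 - ((η₁ - u₁) ^ 2 + (η₂ - u₁) ^ 2)
    let SAu : ℝ := a * u₁ + (-a + y₂) * (ζ₂ - u₁) + (-a + y₃) * (ζ₃ - u₁) + (-a + y₄) * (ζ₄ - u₁)
      - ((-a + w₁) * (η₁ - u₁) + (-a + w₂) * (η₂ - u₁))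
    let SA2u2 : ℝ := a ^ 2 * u₁ ^ 2 + (-a + y₂) ^ 2 * (ζ₂ - u₁) ^ 2 + (-a + y₃) ^ 2 * (ζ₃ - u₁) ^ 2
      + (-a + y₄) ^ 2 * (ζ₄ - u₁) ^ 2 - ((-a + w₁) ^ 2 * (η₁ - u₁) ^ 2 + (-a + w₂) ^ 2 * (η₂ - u₁) ^ 2)
    let Su4 : ℝ := u₁ ^ 4 + (ζ₂ - u₁) ^ 4 + (ζ₃ - u₁) ^ 4 + (ζ₄ - u₁) ^ 4 - ((η₁ - u₁) ^ 4 + (η₂ - u₁) ^ 4)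
    let Q2 : ℝ := 1 / 2 * SA * Su + SAu ^ 2 - 3 * SA2u2
    let Q4 : ℝ := 3 * Su4 - 3 / 2 * Su ^ 2
    Sz * (Q2 + Q4)
      = 4 * Syz2 ^ 2 + 4 * u₁ ^ 2 * (Sy * Sz - 4 * Syz ^ 2 - 6 * Sz ^ 2)
        + Sz * (1 / 2 * Sy * Sz + Syz ^ 2 - 3 * Sy2z2 + 3 * Sz4 - 3 / 2 * Sz ^ 2)
        + 6 * u₁ * Sz * π₁ - (2 * Syz2 + 12 * u₁ * Syz + 2 * π₂) * π₂ - 12 * u₁ * Sz * π₄ := by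
  intro w₂ η₂ Sy Sz Syz Syz2 Sy2z Sy2z2 Sz3 Sz4 π₁ π₂ π₄ SA Su SAu SA2u2 Su4 Q2 Q4
  simp only [Q2, Q4, SA, Su, SAu, SA2u2, Su4, π₁, π₂, π₄, Sy, Sz, Syz, Syz2, Sy2z, Sy2z2, Sz3, Sz4, w₂, η₂]
  ring

/-- CLUSTER FORM on pure configurations: if `P1 = P2 = P4 = 0` (i.e. `π₁ = π₂ = π₄ = 0`) then
`S_ζ·G₀ = 4S_{yζ²}² + 4u₁²(S_yS_ζ − 4S_{yζ}² − 6S_ζ²) + S_ζ(½S_yS_ζ + S_{yζ}² − 3S_{y²ζ²} + 3S_{ζ⁴} − (3/2)S_ζ²)`. -/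
theorem clusterForm_pure (a y₂ y₃ y₄ w₁ ζ₂ ζ₃ ζ₄ η₁ u₁ : ℝ)
    (hP1 : (y₂ ^ 2 * ζ₂ + y₃ ^ 2 * ζ₃ + y₄ ^ 2 * ζ₄ - w₁ ^ 2 * η₁ - (y₂ + y₃ + y₄ - w₁) ^ 2 * (ζ₂ + ζ₃ + ζ₄ - η₁))
        - u₁ * (y₂ ^ 2 + y₃ ^ 2 + y₄ ^ 2 - w₁ ^ 2 - (y₂ + y₃ + y₄ - w₁) ^ 2)
        - 2 * a * (y₂ * ζ₂ + y₃ * ζ₃ + y₄ * ζ₄ - w₁ * η₁ - (y₂ + y₃ + y₄ - w₁) * (ζ₂ + ζ₃ + ζ₄ - η₁)) = 0)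
    (hP2 : (y₂ * ζ₂ ^ 2 + y₃ * ζ₃ ^ 2 + y₄ * ζ₄ ^ 2 - w₁ * η₁ ^ 2 - (y₂ + y₃ + y₄ - w₁) * (ζ₂ + ζ₃ + ζ₄ - η₁) ^ 2)
        - 2 * u₁ * (y₂ * ζ₂ + y₃ * ζ₃ + y₄ * ζ₄ - w₁ * η₁ - (y₂ + y₃ + y₄ - w₁) * (ζ₂ + ζ₃ + ζ₄ - η₁))
        - a * (ζ₂ ^ 2 + ζ₃ ^ 2 + ζ₄ ^ 2 - η₁ ^ 2 - (ζ₂ + ζ₃ + ζ₄ - η₁) ^ 2) = 0)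
    (hP4 : (ζ₂ ^ 3 + ζ₃ ^ 3 + ζ₄ ^ 3 - η₁ ^ 3 - (ζ₂ + ζ₃ + ζ₄ - η₁) ^ 3)
        - 3 * u₁ * (ζ₂ ^ 2 + ζ₃ ^ 2 + ζ₄ ^ 2 - η₁ ^ 2 - (ζ₂ + ζ₃ + ζ₄ - η₁) ^ 2) = 0) :
    let w₂ : ℝ := y₂ + y₃ + y₄ - w₁
    let η₂ : ℝ := ζ₂ + ζ₃ + ζ₄ - η₁
    let Sy : ℝ := y₂ ^ 2 + y₃ ^ 2 + y₄ ^ 2 - w₁ ^ 2 - w₂ ^ 2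
    let Sz : ℝ := ζ₂ ^ 2 + ζ₃ ^ 2 + ζ₄ ^ 2 - η₁ ^ 2 - η₂ ^ 2
    let Syz : ℝ := y₂ * ζ₂ + y₃ * ζ₃ + y₄ * ζ₄ - w₁ * η₁ - w₂ * η₂
    let Syz2 : ℝ := y₂ * ζ₂ ^ 2 + y₃ * ζ₃ ^ 2 + y₄ * ζ₄ ^ 2 - w₁ * η₁ ^ 2 - w₂ * η₂ ^ 2
    let Sy2z2 : ℝ := y₂ ^ 2 * ζ₂ ^ 2 + y₃ ^ 2 * ζ₃ ^ 2 + y₄ ^ 2 * ζ₄ ^ 2 - w₁ ^ 2 * η₁ ^ 2 - w₂ ^ 2 * η₂ ^ 2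
    let Sz4 : ℝ := ζ₂ ^ 4 + ζ₃ ^ 4 + ζ₄ ^ 4 - η₁ ^ 4 - η₂ ^ 4
    let SA : ℝ := a ^ 2 + (-a + y₂) ^ 2 + (-a + y₃) ^ 2 + (-a + y₄) ^ 2 - ((-a + w₁) ^ 2 + (-a + w₂) ^ 2)
    let Su : ℝ := u₁ ^ 2 + (ζ₂ - u₁) ^ 2 + (ζ₃ - u₁) ^ 2 + (ζ₄ - u₁) ^ 2 - ((η₁ - u₁) ^ 2 + (η₂ - u₁) ^ 2)
    let SAu : ℝ := a * u₁ + (-a + y₂) * (ζ₂ - u₁) + (-a + y₃) * (ζ₃ - u₁) + (-a + y₄) * (ζ₄ - u₁)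
      - ((-a + w₁) * (η₁ - u₁) + (-a + w₂) * (η₂ - u₁))
    let SA2u2 : ℝ := a ^ 2 * u₁ ^ 2 + (-a + y₂) ^ 2 * (ζ₂ - u₁) ^ 2 + (-a + y₃) ^ 2 * (ζ₃ - u₁) ^ 2
      + (-a + y₄) ^ 2 * (ζ₄ - u₁) ^ 2 - ((-a + w₁) ^ 2 * (η₁ - u₁) ^ 2 + (-a + w₂) ^ 2 * (η₂ - u₁) ^ 2)
    let Su4 : ℝ := u₁ ^ 4 + (ζ₂ - u₁) ^ 4 + (ζ₃ - u₁) ^ 4 + (ζ₄ - u₁) ^ 4 - ((η₁ - u₁) ^ 4 + (η₂ - u₁) ^ 4)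
    Sz * (1 / 2 * SA * Su + SAu ^ 2 - 3 * SA2u2 + (3 * Su4 - 3 / 2 * Su ^ 2))
      = 4 * Syz2 ^ 2 + 4 * u₁ ^ 2 * (Sy * Sz - 4 * Syz ^ 2 - 6 * Sz ^ 2)
        + Sz * (1 / 2 * Sy * Sz + Syz ^ 2 - 3 * Sy2z2 + 3 * Sz4 - 3 / 2 * Sz ^ 2) := by
  intro w₂ η₂ Sy Sz Syz Syz2 Sy2z2 Sz4 SA Su SAu SA2u2 Su4
  have h := clusterForm_identity a y₂ y₃ y₄ w₁ ζ₂ ζ₃ ζ₄ η₁ u₁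
  simp only at h
  simp only [SA, Su, SAu, SA2u2, Su4, Sy, Sz, Syz, Syz2, Sy2z2, Sz4, w₂, η₂]
  linear_combination h + (6 * u₁ * (ζ₂ ^ 2 + ζ₃ ^ 2 + ζ₄ ^ 2 - η₁ ^ 2 - (ζ₂ + ζ₃ + ζ₄ - η₁) ^ 2)) * hP1
    - (2 * (y₂ * ζ₂ ^ 2 + y₃ * ζ₃ ^ 2 + y₄ * ζ₄ ^ 2 - w₁ * η₁ ^ 2 - (y₂ + y₃ + y₄ - w₁) * (ζ₂ + ζ₃ + ζ₄ - η₁) ^ 2)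
        + 12 * u₁ * (y₂ * ζ₂ + y₃ * ζ₃ + y₄ * ζ₄ - w₁ * η₁ - (y₂ + y₃ + y₄ - w₁) * (ζ₂ + ζ₃ + ζ₄ - η₁))
        + 2 * ((y₂ * ζ₂ ^ 2 + y₃ * ζ₃ ^ 2 + y₄ * ζ₄ ^ 2 - w₁ * η₁ ^ 2 - (y₂ + y₃ + y₄ - w₁) * (ζ₂ + ζ₃ + ζ₄ - η₁) ^ 2)
          - 2 * u₁ * (y₂ * ζ₂ + y₃ * ζ₃ + y₄ * ζ₄ - w₁ * η₁ - (y₂ + y₃ + y₄ - w₁) * (ζ₂ + ζ₃ + ζ₄ - η₁))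
          - a * (ζ₂ ^ 2 + ζ₃ ^ 2 + ζ₄ ^ 2 - η₁ ^ 2 - (ζ₂ + ζ₃ + ζ₄ - η₁) ^ 2))) * hP2
    - (12 * u₁ * (ζ₂ ^ 2 + ζ₃ ^ 2 + ζ₄ ^ 2 - η₁ ^ 2 - (ζ₂ + ζ₃ + ζ₄ - η₁) ^ 2)) * hP4

end Summit.HodgeConjecture.HodgeConjecture.WeilClassTestEscapeDirections
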